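import Literature.Analysis.FluidPDE.SteadyNSLatticePersistence

/-!
# Eigenvalues of the linearised Navier–Stokes operator on `T³` from the Fourier lattice:
# rapidly decaying solutions of the lattice eigen-equation synthesise classical eigenpairs

Analysis/FluidPDE proof file (theorems only; no definitions, no named facts), a one-theorem sequel
of `SteadyNSLatticePersistence` §K. There, `SteadyLattice.isLinNSEigenvalue_of_fourier` turns a
rapidly decaying non-zero KERNEL vector of the linearised lattice operator at a smooth
divergence-free `u₀`,
`c ↦ ν·4π²|k|² c(k) + Π_k [N(û₀, c)(k) + N(c, û₀)(k)]`
(`N = ScalarFourier.transportSym` componentwise = the Fourier side of `(u·∇)v`, `Π_k = Torus.lerayCoeff k`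
the Leray multiplier), into a classical eigenpair of `Torus.linearizedNSOperator ν u₀` with eigenvalue
`0` (`Torus.IsLinNSEigenvalue ν u₀ 0` of `LinearizedNSTorus`). Here the same synthesis is carried out
for an ARBITRARY complex eigenvalue `μ`:

* `SteadyLattice.isLinNSEigenvalue_of_fourier_eigen` — if `c : ℤ³ → ℂ³` is rapidly decaying,
  transversal (`k·c(k) = 0`), mean-free (`c(0) = 0`), non-zero, and solves the lattice eigen-equation
  `ν·4π²|k|² c(k) + Π_k [N(û₀, c)(k) + N(c, û₀)(k)] + μ c(k) = 0` for every `k`, then `μ` is an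
  eigenvalue of the linearisation `L(ν, u₀) w = νΔw − (u₀·∇)w − (w·∇)u₀ − ∇q`: the synthesis
  `w = ∑ e_k c(k)` is a smooth divergence-free mean-zero field and, with the smooth pressure of symbol
  `−(k·M(k))/(2πi|k|²)`, `M(k) = N(û₀, c)(k) + N(c, û₀)(k)`, one has `L(ν,u₀)(w,q) = μ w` pointwise.

This is the Fourier-series form of the classical fact that the point spectrum of the (compact-resolvent)
linearised operator is read off the lattice equations mode by mode (Constantin–Foias 1988, Ch. 4 and
Ch. 7: Stokes operator diagonal in the Fourier basis, `B(u,v) = P(u·∇v)`); it is the SYNTHESIS step by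
which a lattice-side eigenvector certificate (e.g. a Galerkin/section certificate with a regularity
bootstrap in coefficients) reaches `Torus.IsLinNSEigenvalue`.

Mathlib / tree search: everything used is in `SteadyNSLatticePersistence` (§C symbol algebra
`nl_zero_of_transversal`, `summable_nl_rapid`; §H dictionary `mFourierCoeff_convect_complex`,
`mFourierCoeff_stretch`, `mFourierCoeff_gradientC`, `isSmooth_stretch`; §K `rapidDecay_pressureSymbol`,
`sub_lerayCoeff`, `kdot_sub'`, `kdot_zero`) and the torus Fourier calculus
(`RapidDecay.isSmooth_fourierSynth`, `eq_zero_of_forall_mFourierCoeff_eq_zero`,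
`Torus.mFourierCoeff_laplacian`, `mFourierCoeff_const_smul`).

## References

* P. Constantin, C. Foias, *Navier–Stokes Equations*, Univ. Chicago Press (1988), Ch. 4
  (periodic case, (4.11)–(4.14)) and Ch. 7. [ConstantinFoiasNSE1988]
* L. Grafakos, *Classical Fourier Analysis*, 3rd ed., GTM 249 (2014), Prop. 3.2.5, Thm. 3.3.9.
  [Grafakos2014]
-/

noncomputable section

open scoped BigOperators Topology ENNReal NNReal InnerProductSpace ComplexConjugate
open Filter Set Function TopologicalSpace MeasureTheory UnitAddTorus

namespace Literature.Analysis.FluidPDE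

namespace SteadyLattice

open Literature.Analysis.FunctionSpaces Literature.Analysis.FunctionSpaces.Torus
open Literature.Analysis.FunctionSpaces.EuclideanSpace
open Literature.Analysis.FluidPDE.ScalarFourier

section Eigenvalue

set_option maxHeartbeats 800000 in
/-- **From a rapidly decaying non-zero solution of the lattice eigen-equation to a classical
eigenpair** of the linearised Navier–Stokes operator `L(ν, u₀) w = νΔw − (u₀·∇)w − (w·∇)u₀ − ∇q` at a
smooth divergence-free `u₀` on `T³`: if `c : ℤ³ → ℂ³` is rapidly decaying, transversal, mean-free and
non-zero with `ν·4π²|k|² c(k) + Π_k [N(û₀, c)(k) + N(c, û₀)(k)] + μ c(k) = 0` for all `k`, then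
`Torus.IsLinNSEigenvalue ν u₀ μ` (Fourier synthesis `w = ∑ e_k c(k)` with the pressure of symbol
`−(k·M(k))/(2πi|k|²)`): the point spectrum of `L(ν,u₀) = −νA − B(u₀,·) − B(·,u₀)` on the periodic
energy space read in the Fourier basis, where the Stokes operator `A` is diagonal and `B(u,v) = P(u·∇v)`
(Constantin–Foias 1988, Ch. 4, (4.11)–(4.14), periodic case; Ch. 7, the linearised operator). The case
`μ = 0` is `isLinNSEigenvalue_of_fourier`. [cite: ConstantinFoiasNSE1988, Ch. 4 (4.11)–(4.14) and Ch. 7] -/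
theorem isLinNSEigenvalue_of_fourier_eigen {ν : ℝ} {u₀ : (UnitAddTorus (Fin 3)) → (EuclideanSpace ℝ (Fin 3))}
    (hu₀ : IsSmooth u₀) (hdiv₀ : IsDivFree u₀) {μ : ℂ}
    {c : (Fin 3 → ℤ) → (EuclideanSpace ℂ (Fin 3))} (hc : RapidDecay c) (hct : ∀ k : (Fin 3 → ℤ), (∑ jj : Fin 3, ((k
        jj : ℤ) : ℂ) * (c k) jj) = 0) (hc0 : c 0 = 0) (hcne : c ≠ 0)
    (heq : ∀ k : (Fin 3 → ℤ), (((ν * (4 * Real.pi ^ 2 * freqNormSq k)) : ℝ) : ℂ) • c k +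
      Torus.lerayCoeff k ((WithLp.toLp 2 (fun pp : Fin 3 => transportSym (fun jj mm => (mFourierCoeff (complexify
          ∘ u₀)) mm jj) (fun mm => c mm pp) k) : EuclideanSpace ℂ (Fin 3)) + (WithLp.toLp 2 (fun pp : Fin
          3 => transportSym (fun jj mm => c mm jj) (fun mm => (mFourierCoeff (complexify ∘ u₀)) mm pp) k) :
          EuclideanSpace ℂ (Fin 3))) + μ • c k = 0) :
    Torus.IsLinNSEigenvalue ν u₀ μ := by
  set a : (Fin 3 → ℤ) → (EuclideanSpace ℂ (Fin 3)) := mFourierCoeff (complexify ∘ u₀) with ha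
  have har : RapidDecay a := hu₀.complexify_comp.rapidDecay_mFourierCoeff
  have hat : ∀ m : (Fin 3 → ℤ), (∑ jj : Fin 3, ((m jj : ℤ) : ℂ) * (a m) jj) = 0 :=
      fun m => hdiv₀.sum_mul_mFourierCoeff_eq_zero hu₀ m
  -- the linearised convective symbol `M(k) = N(û₀, c)(k) + N(c, û₀)(k)`
  set M : (Fin 3 → ℤ) → (EuclideanSpace ℂ (Fin 3)) := fun k => (WithLp.toLp 2 (fun pp : Fin 3 => transportSym
      (fun jj mm => a mm jj) (fun mm => c mm pp) k) : EuclideanSpace ℂ (Fin 3)) + (WithLp.toLp 2 (fun pp : Fin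
      3 => transportSym (fun jj mm => c mm jj) (fun mm => a mm pp) k) : EuclideanSpace ℂ (Fin 3)) with hMdef
  have heq' : ∀ k : (Fin 3 → ℤ), (((ν * (4 * Real.pi ^ 2 * freqNormSq k)) : ℝ) : ℂ) • c k +
      Torus.lerayCoeff k (M k) + μ • c k = 0 := fun k => heq k
  -- the velocity
  set w : (UnitAddTorus (Fin 3)) → (EuclideanSpace ℂ (Fin 3)) := fourierSynth c with hwdef
  have hw : IsSmooth w := hc.isSmooth_fourierSynth
  have hŵ : mFourierCoeff w = c := funext hc.mFourierCoeff_fourierSynth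
  -- the linearised convective symbol is the coefficient family of a smooth field
  have hM : ∀ k, mFourierCoeff (Torus.convect u₀ w) k + mFourierCoeff (Torus.stretch w u₀) k = M k := by
    intro k
    rw [mFourierCoeff_convect_complex hu₀ hw k, mFourierCoeff_stretch hu₀ hw k, hŵ]
  have hMr : RapidDecay M := by
    have h := ((hu₀.convect hw).rapidDecay_mFourierCoeff).add ((isSmooth_stretch hu₀ hw).rapidDecay_mFourierCoeff)
    have e : mFourierCoeff (Torus.convect u₀ w) + mFourierCoeff (Torus.stretch w u₀) = M := funext hM
    rwa [e] at h
  have hM0 : M 0 = 0 := by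
    change (WithLp.toLp 2 (fun pp : Fin 3 => transportSym (fun jj mm => a mm jj) (fun mm => c mm pp) 0) :
      EuclideanSpace ℂ (Fin 3)) + (WithLp.toLp 2 (fun pp : Fin 3 => transportSym (fun jj mm => c mm jj) (fun mm => a
      mm pp) 0) : EuclideanSpace ℂ (Fin 3)) = 0
    rw [nl_zero_of_transversal a c hat (fun j p => summable_nl_rapid har hc 0 j p),
      nl_zero_of_transversal c a hct (fun j p => summable_nl_rapid hc har 0 j p), add_zero]
  -- the pressure
  set qh : (Fin 3 → ℤ) → ℂ := fun k => (∑ jj : Fin 3, ((k jj : ℤ) : ℂ) * (-(M k)) jj)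
      / (2 * Real.pi * Complex.I * ((freqNormSq k : ℝ) : ℂ)) with hqh
  have hqhr : RapidDecay qh := by
    have hg : RapidDecay (fun k => -(M k)) := by
      have := hMr.const_smul (-1)
      convert this using 1
      funext k
      exact (neg_one_smul ℂ _).symm
    exact rapidDecay_pressureSymbol hg
  set q : (UnitAddTorus (Fin 3)) → ℂ := fourierSynth qh with hq
  have hqs : IsSmooth q := hqhr.isSmooth_fourierSynth
  have hqc : ∀ k, mFourierCoeff q k = qh k := hqhr.mFourierCoeff_fourierSynth
  -- the eigen-residual `E = L(ν,u₀)(w,q) − μ w`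
  set E : (UnitAddTorus (Fin 3)) → (EuclideanSpace ℂ (Fin 3)) := fun y => Torus.linearizedNSOperator ν u₀ w q y -
      μ • w y with hEdef
  have c4 : Continuous fun y => Torus.gradientC q y :=
    (PiLp.continuous_toLp 2 _).comp (continuous_pi fun l => (hqs.partialDeriv l).continuous)
  have hEc : Continuous E := by
    have c1 : Continuous fun y => laplacian w y := hw.laplacian.continuous
    have c2 : Continuous (Torus.convect u₀ w) := (hu₀.convect hw).continuous
    have c3 : Continuous (Torus.stretch w u₀) := (isSmooth_stretch hu₀ hw).continuous
    have c5 : Continuous fun y => μ • w y := hw.continuous.const_smul μ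
    simp only [hEdef, Torus.linearizedNSOperator_apply]
    exact (((c1.const_smul ν).sub (c2.add c3)).sub c4).sub c5
  have hEcoeff : ∀ k, mFourierCoeff E k = 0 := by
    intro k
    have i1 : Integrable (fun y => laplacian w y) volume := hw.laplacian.integrable
    have i1' : Integrable ((ν : ℂ) • fun y => laplacian w y) volume := i1.smul (ν : ℂ)
    have i2 : Integrable (Torus.convect u₀ w) volume := (hu₀.convect hw).integrable
    have i3 : Integrable (Torus.stretch w u₀) volume := (isSmooth_stretch hu₀ hw).integrable
    have i4 : Integrable (Torus.gradientC q) volume := Continuous.integrable_unitAddTorus c4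
    have i5 : Integrable (μ • w) volume := hw.integrable.smul μ
    have hfun : E = (((ν : ℂ) • fun y => laplacian w y) - (Torus.convect u₀ w + Torus.stretch w u₀) -
        Torus.gradientC q) - μ • w := by
      funext y
      simp only [hEdef, Torus.linearizedNSOperator_apply, Pi.sub_apply, Pi.add_apply, Pi.smul_apply,
        Complex.coe_smul]
    rw [hfun, mFourierCoeff_sub ((i1'.sub (i2.add i3)).sub i4) i5, mFourierCoeff_sub (i1'.sub (i2.add i3)) i4,
      mFourierCoeff_sub i1' (i2.add i3), mFourierCoeff_add i2 i3, mFourierCoeff_const_smul, hM k,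
      mFourierCoeff_gradientC hqs k, hqc k,
      show (μ • w) = μ • fourierSynth c from rfl, show (fun y => laplacian w y) = laplacian w from rfl,
      Torus.mFourierCoeff_laplacian hw k, hŵ]
    have hsm : mFourierCoeff (μ • fourierSynth c) k = μ • c k := by
      rw [show (μ • fourierSynth c) = μ • w from rfl, mFourierCoeff_const_smul, hŵ]
    rw [hsm]
    by_cases hk : k = 0
    · subst hk
      rw [hM0, freqNormSq_zero, Torus.freqVec_zero, smul_zero, hc0]
      simp
    · have h1 := heq' k
      have hq' : ((freqNormSq k : ℝ) : ℂ) ≠ 0 := by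
        exact_mod_cast (ne_of_gt (lt_of_lt_of_le one_pos (one_le_freqNormSq' hk)))
      have hI : (2 * Real.pi * Complex.I : ℂ) ≠ 0 :=
        mul_ne_zero (mul_ne_zero two_ne_zero (by exact_mod_cast Real.pi_ne_zero)) Complex.I_ne_zero
      have hsplit := sub_lerayCoeff hk (M k)
      have hcoef : 2 * Real.pi * Complex.I * qh k = -((∑ jj : Fin 3, ((k jj : ℤ) : ℂ) * (M k) jj) /
          ((freqNormSq k : ℝ) : ℂ)) := by
        have e : qh k = -((∑ jj : Fin 3, ((k jj : ℤ) : ℂ) * (M k) jj)) / (2 * Real.pi * Complex.I *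
            ((freqNormSq k : ℝ) : ℂ)) := by
          rw [hqh]
          dsimp only
          rw [show -(M k) = (0 : (EuclideanSpace ℂ (Fin 3))) - M k from (zero_sub _).symm, kdot_sub', kdot_zero,
            zero_sub]
        rw [e]
        field_simp
      rw [hcoef, neg_smul]
      have e3 : (ν : ℂ) • -((((4 * Real.pi ^ 2 * freqNormSq k : ℝ)) : ℂ) • c k) =
          Torus.lerayCoeff k (M k) + μ • c k := by
        rw [smul_neg, smul_smul, ← Complex.ofReal_mul]
        have h1' : (((ν * (4 * Real.pi ^ 2 * freqNormSq k)) : ℝ) : ℂ) • c k =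
            -(Torus.lerayCoeff k (M k) + μ • c k) := by
          rw [eq_neg_iff_add_eq_zero, ← add_assoc]; exact h1
        rw [h1', neg_neg]
      rw [e3]
      linear_combination (norm := module) -hsplit
  have hE0 : E = 0 := eq_zero_of_forall_mFourierCoeff_eq_zero hEc hEcoeff
  -- divergence
  have hdivC : Torus.IsDivFreeC w := by
    intro y
    set D : (UnitAddTorus (Fin 3)) → ℂ := fun z => ∑ l, Torus.partialDeriv l (fun x => w x l) z with hD
    have hwl : ∀ l, IsSmooth (fun x => w x l) := fun l =>
      hw.comp_clm ((EuclideanSpace.proj l : (EuclideanSpace ℂ (Fin 3)) →L[ℂ] ℂ).restrictScalars ℝ)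
    have hDc : Continuous D := continuous_finsetSum _ fun l _ => ((hwl l).partialDeriv l).continuous
    have hDcoeff : ∀ k, mFourierCoeff D k = 0 := by
      intro k
      rw [hD, mFourierCoeff_finset_sum (f := fun l => Torus.partialDeriv l (fun x => w x l)) _
        (fun l _ => ((hwl l).partialDeriv l).integrable)]
      have h2 : ∀ l, mFourierCoeff (Torus.partialDeriv l (fun x => w x l)) k = dsym l k * c k l := fun l => by
        rw [mFourierCoeff_partialDeriv (hwl l) l k, coeff_apply_complex hw k l, hŵ, dsym_apply, smul_eq_mul]
      simp only [h2, dsym_apply]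
      calc ∑ l, 2 * ↑Real.pi * Complex.I * (((k l : ℤ) : ℂ)) * c k l
          = 2 * ↑Real.pi * Complex.I * (∑ jj : Fin 3, ((k jj : ℤ) : ℂ) * (c k) jj) := by
            rw [Finset.mul_sum]; exact Finset.sum_congr rfl fun l _ => by ring
        _ = 0 := by rw [hct k, mul_zero]
    have hD0 : D = 0 := eq_zero_of_forall_mFourierCoeff_eq_zero hDc hDcoeff
    have hy := congrFun hD0 y
    simpa only [hD, Pi.zero_apply, Torus.divergenceC] using hy
  -- zero mean
  have hmean : HasZeroMean w := hasZeroMean_of_mFourierCoeff_zero (by rw [hŵ]; exact hc0)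
  -- non-triviality
  have hwne : w ≠ 0 := by
    intro h0
    apply hcne
    rw [← hŵ, h0]
    funext k
    rw [show (0 : (UnitAddTorus (Fin 3)) → (EuclideanSpace ℂ (Fin 3))) = (0 : ℂ) • (0 : (UnitAddTorus (Fin 3)) →
        (EuclideanSpace ℂ (Fin 3))) by simp, mFourierCoeff_const_smul, zero_smul]
    rfl
  refine ⟨w, hwne, hw, hdivC, hmean, q, hqs, fun y => ?_⟩
  have hy := congrFun hE0 y
  simpa only [hEdef, Pi.zero_apply] using hy

end Eigenvalue

end SteadyLattice

end Literature.Analysis.FluidPDE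

end
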